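import Summits.QuantumFields.YangMills.Theorems.BalabanUVNodesN22KernelLimitOfRealTwoPointLetters
import Summits.QuantumFields.YangMills.Theorems.BalabanUVNodesN22AtKernelsOfActivitySlotsClosed
import Literature.MathematicalPhysics.QuantumFieldTheory.Balaban1983to89.Node00.RateRecordW1Reading

/-!
# NODE N22 (NE9) — THE (1.21)-EXISTENCE LETTER OF RECORD KEYED ON THE CHART-FREE REAL-PROBE LAW (G≈ℝ), and A6: admissible dials exist for every family and the letter fires at
# def-W1's termless tower (third file of the real-probe road, over `…N22KernelLimitOfRealTwoPoint` ∕ `…RealTwoPointLetters`)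

Cell `pub-ymgap`, Track A (HUMAN RULING D-0062), WIDTH SEAT `dag-n22-w3` g4 on node n22 = NE9; `--kind proof --supports stmt-QuantumFields-20544 --as helper` (K3⁷
`SpineGivenEndpointR13SepCoPH`, skeleton v5 941dddb108cbaacf), COUNT-NEUTRAL.  Third file of CLAIM-3 of this seat (pub-ymgap INBOX l.32110 ∕ DECL-DELTA-3 l.32334).

* §5 ★★★ `polLimitsExistOfRecord₁₃_of_realTwoPoint` — W1-19b's `PolLimitsExistOfRecord₁₃ F N θ` under W1-20's law `Localizes17OfRecord₁₃ F N θ S emb` from W1's activity-level value slot, the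
  complexified readings (chart∕space clauses, activity holomorphy), the p. 282 tails, Road-1 numerals, the small∕near class AND the chart-free law (G≈ℝ) at the record's β-chart: «the
  small-domain partial sums of the FINITE-VOLUME (2.13) terms at the real probe families `emb_K(exp θ.ρ8(a·e_{μ,z,c} + b·e_{ν,0,c}))` of the tori `K`, `K+1` are `C r₀^K`-close for real
  `|a|,|b| ≤ r₂`» + the dial `s` with `ρ_s < 1` (p607522 §2 with (S≈) ↦ (G≈ℝ); one application of `polLimitsExist_localizedSum_of_realTwoPoint`).  The `hlim`∕`hL` slot of this seat's
  (1.21) passages and of dag-n27-w1's letters-level composer, now keyed on a law that mentions NO complexification.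
* §6 ★★★ `n22At_rateCarriers_of_kernels_pin_of_activitySlots_of_realTwoPoint` ∕ ★★★ `readOutAt_rateCarriers_of_kernels_pin_of_activitySlots_of_realTwoPoint` — p611742's ROW
  SENTENCES (`N22At (rateCarriersOfRecord₁₃CoPH 𝔯 F θ hP g₀ os k).u3` and the (D4) read-out face at a kernel-PINNED reading, every run length = K3⁷ v5 §2b at the selector's value)
  with (S≈) ↦ (G≈ℝ) + the dial `s`, one application of `approxStable_of_realTwoPoint` each (imports p611742).
* A6 (director-ym №189): `exists_realTwoPoint_dials` — for EVERY family the rate numeral is satisfiable (`r₀ := (L⁴)^{−4}`, `s := 1∕2`, `ρ_s = (L⁴)^{−1∕4} < 1`);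
  `polLimitsExist_localizedSum_of_realTwoPoint_fires_zeroTower` — every hypothesis of `polLimitsExist_localizedSum_of_realTwoPoint` inhabited AT ONCE by def-W1's termless towers
  (`W1.E_termlessTower`: both chart-free sums vanish, (G≈ℝ) with `C := 0`) at the zero chart and those dials — DEGENERATE, declared; the non-degenerate rung needs cross-volume-coherent
  model towers the tree does not have.

HONEST FRAMING (binding).  Count-neutral helper; THEOREMS ONLY (0 def, 0 sorry, standard axioms); one composition, one numeral, one degenerate model witness.  (G≈ℝ), W1's (2.38) value slot,
activity holomorphy through the complexified minimizer reading and the reading itself, the p. 282 tails, W1-20's law `Localizes17OfRecord₁₃` and the Road-1 numerals are DISPLAYED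
HYPOTHESES with their owners (NODE A ∕ def-W1 ∕ N10).  (1.21)'s existence for the terms OF RECORD is NOT proved; nothing of Bałaban's is constructed or asserted; no inhabitant at the datum of
record; N22 NOT discharged (typed 28∕28 · discharged 5∕27 UNMOVED); K3⁷ OPEN, NOT claimed; no count claim (the chair's single count line is the only count); one finite 𝕋⁴ programme at fixed ε —
R4 closes the CONDITIONAL rung `BalabanLadder.UV` only; NOTHING about the continuum limit, ℝ⁴, infinite volume, OS axioms, a mass gap or the Clay problem is proved or claimed by any of this.
No decl carries a cite tag (Summit side); TYPES only: [I] = [Balaban1987RG1] (1.7) p. 261, (1.20)–(1.21) p. 264, p. 282; [II] = [Balaban1988RG2Cluster] (1.26) p. 8, (2.11), (2.13)–(2.14) pp. 14–15, (2.38) p. 20.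
-/

noncomputable section

open Filter Topology Metric Set
open scoped BigOperators

namespace YMDAG.N22.AtKernels

open Literature.MathematicalPhysics.QuantumFieldTheory.Balaban1983to89
open Literature.MathematicalPhysics.QuantumFieldTheory.Balaban1983to89.B12TreeDecay (K₀ kappa₀ K₀_pos kappa₀_nonneg)
open Literature.MathematicalPhysics.QuantumFieldTheory.Balaban1983to89.TreeLengthTorus (TPt torusTreeLen)
open Literature.MathematicalPhysics.QuantumFieldTheory.Balaban1983to89.T4Continuum (T4Family ULoop)
open Literature.MathematicalPhysics.QuantumFieldTheory.Balaban1983to89.T4OutputRate (Window)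
open Literature.MathematicalPhysics.QuantumFieldTheory.Balaban1983to89.Node00 (polScalar polWindow siteOfInt PolLimitExists Stage13Params Stage13HParams U3Letters₁₁ MatA datumOfRecord₁₃CoPH)
open Literature.MathematicalPhysics.QuantumFieldTheory.Balaban1983to89.Node00.Sect2 (domCount domSys CPair)
open Literature.MathematicalPhysics.QuantumFieldTheory.Balaban1983to89.Node00.W1 (ClusterTower ClusterStep termlessTower H_termlessTower E_termlessTower)
open Literature.MathematicalPhysics.QuantumFieldTheory.Balaban1983to89.Node00.LocalizedSum17 (localizedSum ReadingMaps Localizes17OfRecord₁₃)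
open Literature.MathematicalPhysics.QuantumFieldTheory.Balaban1983to89.Node00.U3OfKernels (histPrefix objectsOfRecord₁₃)
open Literature.MathematicalPhysics.QuantumFieldTheory.Balaban1983to89.Node00.U3KernelLetters (PolLimitsExist PolLimitsExistOfRecord₁₃ polLimitsExistOfRecord₁₃_iff_of_localizes)
open Literature.MathematicalPhysics.QuantumFieldTheory.Balaban1983to89.B12Decay510Torus (distCT nearT)
open Literature.MathematicalPhysics.QuantumFieldTheory.Balaban1983to89.B12Decay510 (delta1)
open Literature.MathematicalPhysics.QuantumFieldTheory.Balaban1983to89.B12Decay510Window (K₁)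
open Literature.MathematicalPhysics.QuantumFieldTheory.Balaban1983to89.B12Sec2to5 (betaPrime510)
open YMDAG.UVSplit (N22At ReadOutAt u3OfRecord₁₃ RateReading₁₃CoPH rateCarriersOfRecord₁₃CoPH)

/-! ## §5 At the record (p607522 §2 with (S≈) ↦ (G≈ℝ)); A6 (director-ym №189): admissible dials exist for every family, and the letter fires at def-W1's termless tower -/

section Record

open scoped Matrix.Norms.L2Operator

variable (F : T4Family) (N : ℕ) [NeZero N] {𝔸 : Type*} {M : ℕ} [NeZero M]

open Classical in
/-- ★★★ **THE (1.21)-EXISTENCE LETTER OF RECORD FROM W1's ACTIVITY-LEVEL VALUE SLOT + THE CHART-FREE REAL-PROBE LAW (G≈ℝ) AT A LOCALIZING READING** (LOCATED; p607522 §2 with (S≈) ↦ (G≈ℝ)).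
For towers `S` (cube side `M = L^{m′}`) read through `emb` which LOCALIZE the merged term family of record (W1-20's law `Localizes17OfRecord₁₃ F N θ S emb` — NODE A ∕ N10's), the hypotheses of
`polLimitsExist_localizedSum_of_realTwoPoint` at the record's β-chart `θ.ρ8 ∕ θ.bV` on the window `]0, θ.γ]^ℕ` give W1-19b's `PolLimitsExistOfRecord₁₃ F N θ`.  (G≈ℝ) here reads: the small-domain
partial sums of the FINITE-VOLUME (2.13) terms at the real probe families `emb_K(exp θ.ρ8(a·e_{μ,z,c} + b·e_{ν,0,c}))` converge geometrically — [I] p. 264's sentence about the record's own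
functions; (1.21)'s existence for the terms OF RECORD is NOT thereby proved. [cite: Balaban1987RG1, (1.7) p.261, (1.20)-(1.21) p.264, p.282; Balaban1988RG2Cluster, (1.26) p.8, (2.13)-(2.14) pp.14-15, (2.38) p.20] -/
theorem polLimitsExistOfRecord₁₃_of_realTwoPoint (θ : Stage13Params F N) (m' : ℕ) (hM : M = F.L ^ m')
    (S : (K : ℕ) → ClusterTower (F.P K) 𝔸 M) (emb : ReadingMaps F (MatA N) 𝔸) (hloc : Localizes17OfRecord₁₃ F N θ S emb)
    (Wk : (K k : ℕ) → Set (Fin (k + 1) → ℝ)) (hWk : ∀ g ∈ Window θ.γ, ∀ K k, histPrefix g k ∈ Wk K k)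
    (sp : (K k : ℕ) → (domSys (F.P K) M (k + 1)).Dom → Set (CPair (F.P K) 𝔸)) {A R r₁ κ B₃ δ₀ r r₂ r₀ s : ℝ}
    (hA : 0 ≤ A) (hr₁ : 0 ≤ r₁) (hκ0 : 0 < κ) (hκ : κ ≤ r₁) (hκ4 : kappa₀ (4 * 2 ^ 4) (2 * 4) ≤ κ / 2 / 2) (hrate : r₁ + 2 * (64 * Real.log 162) + 2 ≤ R)
    (hsmall : A * Real.exp (5 * r₁ + 1) * K₀ 64 8 * 9 * 64 ≤ 1) (hB₃ : 0 ≤ B₃) (hδ₀ : 0 < δ₀) (hr : 0 < r)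
    (h238 : ∀ K k, ((S K) k).Bound238 (Wk K k) (sp K k) A R)
    (Ec : ℕ → ℕ → Type*) [∀ K k, NormedAddCommGroup (Ec K k)] [∀ K k, NormedSpace ℂ (Ec K k)]
    (ιc : letI := θ.instVβ₁; letI := θ.instVβ₂; letI := θ.instιβ
      (K k : ℕ) → (domSys (F.P K) M (k + 1)).Dom → ((Fin (F.P K).d → Site (F.P K) (k + 1) → θ.Vβ) →L[ℝ] Ec K k))
    (Φ : (K k : ℕ) → (domSys (F.P K) M (k + 1)).Dom → Ec K k → CPair (F.P K) 𝔸)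
    (U : (K k : ℕ) → (domSys (F.P K) M (k + 1)).Dom → Set (Ec K k)) (hU : ∀ K k X, IsOpen (U K k X)) (hrU : ∀ K k X, ball (0 : Ec K k) r ⊆ U K k X)
    (hHhol : ∀ K k, ∀ hist ∈ Wk K k, ∀ (X Z : (domSys (F.P K) M (k + 1)).Dom), Z.1 ⊆ X.1 →
      DifferentiableOn ℂ (fun z => ((S K) k).H hist (Φ K k X z) Z) (U K k X))
    (hΦemb : letI := θ.instVβ₁; letI := θ.instVβ₂; letI := θ.instιβ
      ∀ K k X (B : Fin (F.P K).d → Site (F.P K) (k + 1) → θ.Vβ),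
        Φ K k X (ιc K k X B) = emb K k (fun l t => NormedSpace.exp (θ.ρ8 (B l t))))
    (hΦsp : ∀ K k X, ∀ z ∈ U K k X, ∀ Z : (domSys (F.P K) M (k + 1)).Dom, Z.1 ⊆ X.1 → Φ K k X z ∈ sp K k Z)
    (w : (K k : ℕ) → (domSys (F.P K) M (k + 1)).Dom → Site (F.P K) (k + 1) → ℝ) (hw₀ : ∀ K k X t, 0 ≤ w K k X t)
    (hw : letI := θ.instVβ₁; letI := θ.instVβ₂; letI := θ.instιβ
      ∀ K k X (l : Fin (F.P K).d) (t : Site (F.P K) (k + 1)) (c : θ.ιβ), ‖ιc K k X (Pi.single l (Pi.single t (θ.bV c)))‖ ≤ w K k X t)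
    (hwB : ∀ K k (X : (domSys (F.P K) M (k + 1)).Dom) (t : Site (F.P K) (k + 1)),
      w K k X t ≤ B₃ * Real.exp (-δ₀ * distCT (domCount (F.P K) M (k + 1)) M (fun i => (ZMod.cast (t i) : ZMod (domCount (F.P K) M (k + 1) * M)))
        (nearT (M := M) (fun i => (ZMod.cast (t i) : ZMod (domCount (F.P K) M (k + 1) * M))) X)))
    (lo : (k K : ℕ) → (domSys (F.P K) M (k + 1)).Dom → Prop) [∀ k K, DecidablePred (lo k K)]
    (hlo : ∀ (k K : ℕ) (X : (domSys (F.P K) M (k + 1)).Dom), ¬ lo k K X →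
      let e : Site (F.P K) (k + 1) → TPt 4 (domCount (F.P K) M (k + 1) * M) := fun x i => (ZMod.cast (x i) : ZMod (domCount (F.P K) M (k + 1) * M))
      (K : ℝ) ≤ torusTreeLen X.1 ∨ (K : ℝ) ≤ distCT (domCount (F.P K) M (k + 1)) M (e (siteOfInt F K (k + 1) 0)) (nearT (M := M) (e (siteOfInt F K (k + 1) 0)) X))
    (hr₂ : 0 < r₂) (hr₂r : (2 * B₃ + 1) * (2 * r₂) ≤ r) (hs0 : 0 < s) (hs1 : s < 1) (hr₀pos : 0 < r₀) (hr₀1 : r₀ ≤ 1)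
    (hρ : (r₀ ^ (1 - s) * ((F.L : ℝ) ^ 4) ^ s) ^ (1 - s) * ((F.L : ℝ) ^ 4) ^ s < 1)
    (hGR : letI := θ.instVβ₁; letI := θ.instVβ₂; letI := θ.instιβ
      ∀ g ∈ Window θ.γ, ∀ (k : ℕ) (μ ν : Fin 4) (z : Fin 4 → ℤ), ∃ (K₀ : ℕ) (C : ℝ), ∀ K : ℕ, K₀ ≤ K → ∀ (c : θ.ιβ) (a b : ℝ), |a| ≤ r₂ → |b| ≤ r₂ →
      ‖∑ X ∈ Finset.univ.filter (lo k (K + 1)), ((S (K + 1)) k).E (histPrefix g k) (emb (K + 1) k (fun l t => NormedSpace.exp (θ.ρ8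
          ((a • (Pi.single (Fin.cast (F.P_d (K + 1)).symm μ) (Pi.single (siteOfInt F (K + 1) (k + 1) z) (θ.bV c)) : Fin (F.P (K + 1)).d → Site (F.P (K + 1)) (k + 1) → θ.Vβ) +
            b • (Pi.single (Fin.cast (F.P_d (K + 1)).symm ν) (Pi.single (siteOfInt F (K + 1) (k + 1) 0) (θ.bV c)) : Fin (F.P (K + 1)).d → Site (F.P (K + 1)) (k + 1) → θ.Vβ)) l t)))) X -
        ∑ X ∈ Finset.univ.filter (lo k K), ((S K) k).E (histPrefix g k) (emb K k (fun l t => NormedSpace.exp (θ.ρ8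
          ((a • (Pi.single (Fin.cast (F.P_d K).symm μ) (Pi.single (siteOfInt F K (k + 1) z) (θ.bV c)) : Fin (F.P K).d → Site (F.P K) (k + 1) → θ.Vβ) +
            b • (Pi.single (Fin.cast (F.P_d K).symm ν) (Pi.single (siteOfInt F K (k + 1) 0) (θ.bV c)) : Fin (F.P K).d → Site (F.P K) (k + 1) → θ.Vβ)) l t)))) X‖ ≤ C * r₀ ^ K) :
    PolLimitsExistOfRecord₁₃ F N θ := by
  letI := θ.instVβ₁; letI := θ.instVβ₂; letI := θ.instιβ
  exact (polLimitsExistOfRecord₁₃_iff_of_localizes F N θ S emb hloc).2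
    (polLimitsExist_localizedSum_of_realTwoPoint F m' M hM S emb θ.ρ8 θ.bV (Window θ.γ) Wk hWk sp hA hr₁ hκ0 hκ hκ4 hrate hsmall hB₃ hδ₀ hr h238
      Ec ιc Φ U hU hrU hHhol hΦemb hΦsp w hw₀ hw hwB lo hlo hr₂ hr₂r hs0 hs1 hr₀pos hr₀1 hρ hGR)

end Record

section A6

variable {𝔄 : Type*} [NormedRing 𝔄] [NormedAlgebra ℝ 𝔄] {𝔸 : Type*}
variable {V : Type*} [NormedAddCommGroup V] [NormedSpace ℝ V] {ι : Type*} [Fintype ι]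
variable (F : T4Family)

/-- **ADMISSIBLE DIALS EXIST FOR EVERY FAMILY** (the rate numeral of `polLimitsExist_localizedSum_of_realTwoPoint` is satisfiable): with `μ = L⁴ > 1`, the dials `r₀ := μ^{−4} ∈ ]0, 1]`,
`s := 1∕2` give `ρ_s = (r₀^{1∕2}μ^{1∕2})^{1∕2}μ^{1∕2} = μ^{−1∕4} < 1`. [folklore] -/
theorem exists_realTwoPoint_dials : ∃ r₀ s : ℝ, 0 < r₀ ∧ r₀ ≤ 1 ∧ 0 < s ∧ s < 1 ∧
    (r₀ ^ (1 - s) * ((F.L : ℝ) ^ 4) ^ s) ^ (1 - s) * ((F.L : ℝ) ^ 4) ^ s < 1 := by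
  have hL1 : (1 : ℝ) < F.L := by exact_mod_cast F.hL.2
  have hμ1 : (1 : ℝ) < (F.L : ℝ) ^ 4 := one_lt_pow₀ hL1 (by norm_num)
  have hμ0 : (0 : ℝ) < (F.L : ℝ) ^ 4 := zero_lt_one.trans hμ1
  refine ⟨((F.L : ℝ) ^ 4) ^ (-4 : ℝ), 1 / 2, Real.rpow_pos_of_pos hμ0 _, Real.rpow_le_one_of_one_le_of_nonpos hμ1.le (by norm_num),
    by norm_num, by norm_num, ?_⟩
  rw [show (1 : ℝ) - 1 / 2 = 1 / 2 from by norm_num, ← Real.rpow_mul hμ0.le, ← Real.rpow_add hμ0, ← Real.rpow_mul hμ0.le, ← Real.rpow_add hμ0]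
  exact Real.rpow_lt_one_of_one_lt_of_neg hμ1 (by norm_num)

open Classical in
/-- ★ **A6 — THE (G≈ℝ)-KEYED LETTER FIRES AT THE TERMLESS TOWER AND THE ZERO CHART, AT EVERY ADMISSIBLE DIAL PAIR** (`0 < r₀ ≤ 1`, `0 < s < 1`, `ρ_s < 1` — inhabited for every
family by `exists_realTwoPoint_dials`; the dials are kept as parameters so that the statement is not the (G≈)-keyed witness of p616912 §4 verbatim).  For every cube exponent `m′`, reading maps
`emb`, basis `bV` and window `W`, ALL other hypotheses of `polLimitsExist_localizedSum_of_realTwoPoint` hold SIMULTANEOUSLY for def-W1's termless towers `W1.termlessTower (F.P K) 𝔸 (L^{m′})` (`H ≡ 0`, `E ≡ 0` by `W1.E_termlessTower`, so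
(2.38) with `A := 0` and (G≈ℝ) with `C := 0`: both chart-free sums vanish) at the zero chart `ρ := 0` (`ιc := 0`, `Φ :=` the constant reading `emb K k 1`, `U := univ`, `r := 1`, `r₂ := 1∕2`,
`w := 0`, `B₃ := 0`, `δ₀ := 1`, `κ := r₁ := 4κ₀(64,8) + 1`, every domain «small») — and the theorem YIELDS `PolLimitsExist F (localizedSum F termlessTower emb) 0 bV W`.
HONEST: a DEGENERATE model witness (binder shapes jointly satisfiable, the rate numeral included; composition elaborates); it says nothing about the towers or the chart OF RECORD. -/
theorem polLimitsExist_localizedSum_of_realTwoPoint_fires_zeroTower (m' : ℕ) [NeZero (F.L ^ m')]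
    (emb : ReadingMaps F 𝔄 𝔸) (bV : Module.Basis ι ℝ V) (W : Set (ℕ → ℝ)) {r₀ s : ℝ} (hr₀pos : 0 < r₀) (hr₀1 : r₀ ≤ 1) (hs0 : 0 < s) (hs1 : s < 1)
    (hρ : (r₀ ^ (1 - s) * ((F.L : ℝ) ^ 4) ^ s) ^ (1 - s) * ((F.L : ℝ) ^ 4) ^ s < 1) :
    PolLimitsExist F (localizedSum F (fun K => termlessTower (F.P K) 𝔸 (F.L ^ m')) emb) (0 : V →L[ℝ] 𝔄) bV W := by
  have hH : ∀ (K k : ℕ) (hist : Fin (k + 1) → ℝ) (φ : CPair (F.P K) 𝔸) (Z : (domSys (F.P K) (F.L ^ m') (k + 1)).Dom),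
      (termlessTower (F.P K) 𝔸 (F.L ^ m') k).H hist φ Z = 0 := fun K k hist φ Z => H_termlessTower k hist φ Z
  have hE : ∀ (K k : ℕ) (hist : Fin (k + 1) → ℝ) (φ : CPair (F.P K) 𝔸) (X : (domSys (F.P K) (F.L ^ m') (k + 1)).Dom),
      (termlessTower (F.P K) 𝔸 (F.L ^ m') k).E hist φ X = 0 := fun K k hist φ X => E_termlessTower k hist φ X
  refine polLimitsExist_localizedSum_of_realTwoPoint F m' (F.L ^ m') rfl _ emb 0 bV W (fun _ _ => Set.univ) (fun _ _ _ _ => Set.mem_univ _)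
    (fun _ _ _ => Set.univ) (A := 0) (R := (4 * kappa₀ (4 * 2 ^ 4) (2 * 4) + 1) + 2 * (64 * Real.log 162) + 2) (r₁ := 4 * kappa₀ (4 * 2 ^ 4) (2 * 4) + 1)
    (κ := 4 * kappa₀ (4 * 2 ^ 4) (2 * 4) + 1) (B₃ := 0) (δ₀ := 1) (r := 1) (r₂ := 1 / 2) (r₀ := r₀) (s := s)
    le_rfl (kappa_four_smoke).1.le (kappa_four_smoke).1 le_rfl (kappa_four_smoke).2 le_rfl (by simp) le_rfl one_pos one_pos
    (fun K k g _ Z φ _ => by rw [hH, norm_zero, zero_mul])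
    (fun _ _ => ℂ) (fun K k _ => (0 : (Fin (F.P K).d → Site (F.P K) (k + 1) → V) →L[ℝ] ℂ)) (fun K k _ _ => emb K k (fun _ _ => 1)) (fun _ _ _ => Set.univ)
    (fun _ _ _ => isOpen_univ) (fun _ _ _ => Set.subset_univ _)
    (fun K k hist _ X Z _ => by simp only [hH]; exact differentiableOn_const 0)
    (fun K k X B => by simp only [zero_apply, NormedSpace.exp_zero])
    (fun _ _ _ _ _ _ _ => Set.mem_univ _)
    (fun _ _ _ _ => 0) (fun _ _ _ _ => le_rfl) (fun _ _ _ _ _ _ => by rw [zero_apply, norm_zero]) (fun _ _ _ _ => by rw [zero_mul])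
    (fun _ _ _ => True) (fun _ _ _ h => (h trivial).elim) (by norm_num) (by norm_num) hs0 hs1 hr₀pos hr₀1 hρ
    (fun g _ k μ ν z => ⟨0, 0, fun K _ c a b _ _ => by simp [hE]⟩)

end A6



/-! ## §6 THE ROW SENTENCES KEYED ON (G≈ℝ): p611742's `N22At` and (D4) read-out faces at a kernel-pinned reading of record, every run length, with (S≈) ↦ (G≈ℝ) -/

section Row

open scoped Matrix.Norms.L2Operator

variable (F : T4Family) {N : ℕ} [NeZero N] {M : ℕ} [NeZero M]

open Classical in
/-- ★★★ **THE N22 ROW AT (β) KEYED ON THE CHART-FREE REAL-PROBE LAW (G≈ℝ)**: p611742's `n22At_rateCarriers_of_kernels_pin_of_activitySlots_of_approxStable` —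
`N22At (rateCarriersOfRecord₁₃CoPH 𝔯 F θ hP g₀ os k).u3` for EVERY `k` at a kernel-PINNED Stage-13 rate reading (K3⁷ v5's `U3PinnedKernels 𝔯 ℓ` at the tuple) from the law, W1's two
activity slots, the complexified readings, tails, Road-1 numerals, `M = L^{m′}`, the small∕near class, the dominating letter block — with (S≈) REPLACED by (G≈ℝ) + the dial `s` (one
application of `approxStable_of_realTwoPoint`).  LOCATED (hypothesis form); N22 NOT discharged. [cite: Balaban1987RG1, (1.7) p.261, (1.18) p.263, (1.20)-(1.21) p.264, p.282; Balaban1988RG2Cluster, (1.26) p.8, (2.13)-(2.14) pp.14-15, (2.38) p.20] -/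
theorem n22At_rateCarriers_of_kernels_pin_of_activitySlots_of_realTwoPoint (𝔯 : RateReading₁₃CoPH N) (θ : Stage13HParams F N) (hP : θ.Provisos₁₃CoPH F N)
    (g₀ : ℕ → ℝ) (os : List (ULoop F)) (ℓ : U3Letters₁₁) (hs : ℓ.Signs) (hpin : (𝔯.lit F θ hP g₀ os).u3 = objectsOfRecord₁₃ F N θ.toStage13Params ℓ)
    (m' : ℕ) (hM : M = F.L ^ m')
    (S : (K : ℕ) → ClusterTower (F.P K) (MatA N) M) (emb : ReadingMaps F (MatA N) (MatA N)) (hloc : Localizes17OfRecord₁₃ F N θ.toStage13Params S emb)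
    (Wk : (K k : ℕ) → Set (Fin (k + 1) → ℝ)) (hWk : ∀ g ∈ Window θ.γ, ∀ K k, histPrefix g k ∈ Wk K k)
    (sp : (K k : ℕ) → (domSys (F.P K) M (k + 1)).Dom → Set (CPair (F.P K) (MatA N))) {A R r₁ κ B₃ δ₀ r r₂ r₀ s : ℝ} (Λ : ℕ → ℕ → ℝ)
    (hA : 0 < A) (hr₁ : 0 ≤ r₁) (hκ0 : 0 < κ) (hκ : κ ≤ r₁) (hκ4 : kappa₀ (4 * 2 ^ 4) (2 * 4) ≤ κ / 2 / 2) (hrate : r₁ + 2 * (64 * Real.log 162) + 2 ≤ R)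
    (hsmall : 2 * A * Real.exp (5 * r₁ + 1) * K₀ 64 8 * 9 * 64 ≤ 1) (hΛ : ∀ k i, 0 ≤ Λ k i) (hB₃ : 0 ≤ B₃) (hδ₀ : 0 < δ₀) (hr : 0 < r)
    (h238 : ∀ K k, ((S K) k).Bound238 (Wk K k) (sp K k) A R)
    (hYL : ∀ K k, ((S K) k).YoungLipschitz (Wk K k) (sp K k) (fun i : Fin (k + 1) => Λ (k + 1) i) R)
    (Ec : ℕ → ℕ → Type*) [∀ K k, NormedAddCommGroup (Ec K k)] [∀ K k, NormedSpace ℂ (Ec K k)]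
    (ιc : letI := θ.instVβ₁; letI := θ.instVβ₂; letI := θ.instιβ
      (K k : ℕ) → (domSys (F.P K) M (k + 1)).Dom → ((Fin (F.P K).d → Site (F.P K) (k + 1) → θ.Vβ) →L[ℝ] Ec K k))
    (Φ : (K k : ℕ) → (domSys (F.P K) M (k + 1)).Dom → Ec K k → CPair (F.P K) (MatA N))
    (U : (K k : ℕ) → (domSys (F.P K) M (k + 1)).Dom → Set (Ec K k)) (hU : ∀ K k X, IsOpen (U K k X)) (hrU : ∀ K k X, ball (0 : Ec K k) r ⊆ U K k X)
    (hHhol : ∀ K k, ∀ hist ∈ Wk K k, ∀ (X Z : (domSys (F.P K) M (k + 1)).Dom), Z.1 ⊆ X.1 →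
      DifferentiableOn ℂ (fun z => ((S K) k).H hist (Φ K k X z) Z) (U K k X))
    (hΦemb : letI := θ.instVβ₁; letI := θ.instVβ₂; letI := θ.instιβ
      ∀ K k X (B : Fin (F.P K).d → Site (F.P K) (k + 1) → θ.Vβ),
        Φ K k X (ιc K k X B) = emb K k (fun l t => NormedSpace.exp (θ.ρ8 (B l t))))
    (hΦsp : ∀ K k X, ∀ z ∈ U K k X, ∀ Z : (domSys (F.P K) M (k + 1)).Dom, Z.1 ⊆ X.1 → Φ K k X z ∈ sp K k Z)
    (w : (K k : ℕ) → (domSys (F.P K) M (k + 1)).Dom → Site (F.P K) (k + 1) → ℝ) (hw₀ : ∀ K k X t, 0 ≤ w K k X t)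
    (hw : letI := θ.instVβ₁; letI := θ.instVβ₂; letI := θ.instιβ
      ∀ K k X (l : Fin (F.P K).d) (t : Site (F.P K) (k + 1)) (c : θ.ιβ), ‖ιc K k X (Pi.single l (Pi.single t (θ.bV c)))‖ ≤ w K k X t)
    (hwB : ∀ K k (X : (domSys (F.P K) M (k + 1)).Dom) (t : Site (F.P K) (k + 1)),
      w K k X t ≤ B₃ * Real.exp (-δ₀ * distCT (domCount (F.P K) M (k + 1)) M (fun i => (ZMod.cast (t i) : ZMod (domCount (F.P K) M (k + 1) * M)))
        (nearT (M := M) (fun i => (ZMod.cast (t i) : ZMod (domCount (F.P K) M (k + 1) * M))) X)))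
    (lo : (k K : ℕ) → (domSys (F.P K) M (k + 1)).Dom → Prop) [∀ k K, DecidablePred (lo k K)]
    (hlo : ∀ (k K : ℕ) (X : (domSys (F.P K) M (k + 1)).Dom), ¬ lo k K X →
      let e : Site (F.P K) (k + 1) → TPt 4 (domCount (F.P K) M (k + 1) * M) := fun x i => (ZMod.cast (x i) : ZMod (domCount (F.P K) M (k + 1) * M))
      (K : ℝ) ≤ torusTreeLen X.1 ∨ (K : ℝ) ≤ distCT (domCount (F.P K) M (k + 1)) M (e (siteOfInt F K (k + 1) 0)) (nearT (M := M) (e (siteOfInt F K (k + 1) 0)) X))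
    (hr₂ : 0 < r₂) (hr₂r : (2 * B₃ + 1) * (2 * r₂) ≤ r) (hs0 : 0 < s) (hs1 : s < 1) (hr₀pos : 0 < r₀) (hr₀1 : r₀ ≤ 1)
    (hρ : (r₀ ^ (1 - s) * ((F.L : ℝ) ^ 4) ^ s) ^ (1 - s) * ((F.L : ℝ) ^ 4) ^ s < 1)
    (hGR : letI := θ.instVβ₁; letI := θ.instVβ₂; letI := θ.instιβ
      ∀ g ∈ Window θ.γ, ∀ (k : ℕ) (μ ν : Fin 4) (z : Fin 4 → ℤ), ∃ (K₀ : ℕ) (C : ℝ), ∀ K : ℕ, K₀ ≤ K → ∀ (c : θ.ιβ) (a b : ℝ), |a| ≤ r₂ → |b| ≤ r₂ →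
      ‖∑ X ∈ Finset.univ.filter (lo k (K + 1)), ((S (K + 1)) k).E (histPrefix g k) (emb (K + 1) k (fun l t => NormedSpace.exp (θ.ρ8
          ((a • (Pi.single (Fin.cast (F.P_d (K + 1)).symm μ) (Pi.single (siteOfInt F (K + 1) (k + 1) z) (θ.bV c)) : Fin (F.P (K + 1)).d → Site (F.P (K + 1)) (k + 1) → θ.Vβ) +
            b • (Pi.single (Fin.cast (F.P_d (K + 1)).symm ν) (Pi.single (siteOfInt F (K + 1) (k + 1) 0) (θ.bV c)) : Fin (F.P (K + 1)).d → Site (F.P (K + 1)) (k + 1) → θ.Vβ)) l t)))) X -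
        ∑ X ∈ Finset.univ.filter (lo k K), ((S K) k).E (histPrefix g k) (emb K k (fun l t => NormedSpace.exp (θ.ρ8
          ((a • (Pi.single (Fin.cast (F.P_d K).symm μ) (Pi.single (siteOfInt F K (k + 1) z) (θ.bV c)) : Fin (F.P K).d → Site (F.P K) (k + 1) → θ.Vβ) +
            b • (Pi.single (Fin.cast (F.P_d K).symm ν) (Pi.single (siteOfInt F K (k + 1) 0) (θ.bV c)) : Fin (F.P K).d → Site (F.P K) (k + 1) → θ.Vβ)) l t)))) X‖ ≤ C * r₀ ^ K)
    (hℓκ : ℓ.κ ≤ delta1 δ₀ κ ((M : ℝ) * 4))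
    (hdom : ∀ k i, (16 * (8 * (Real.exp 1 * 9 * 64 * K₀ 64 8 ^ 2)) * B₃ ^ 2 / r ^ 2) *
        Real.exp (delta1 δ₀ κ ((M : ℝ) * 4) * ((M : ℝ) * 4) * 3) * K₀ (4 * 2 ^ 4) (2 * 4) * K₁ 4 (δ₀ / 2) * Λ k i ≤ ℓ.moduli k i) (k : ℕ) :
    N22At (rateCarriersOfRecord₁₃CoPH 𝔯 F θ hP g₀ os k).u3 :=
  letI := θ.instVβ₁; letI := θ.instVβ₂; letI := θ.instιβ
  have hρ0 : 0 ≤ (r₀ ^ (1 - s) * ((F.L : ℝ) ^ 4) ^ s) ^ (1 - s) * ((F.L : ℝ) ^ 4) ^ s :=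
    mul_nonneg (Real.rpow_nonneg (mul_nonneg (Real.rpow_nonneg hr₀pos.le _) (Real.rpow_nonneg (pow_nonneg (Nat.cast_nonneg _) 4) _)) _)
      (Real.rpow_nonneg (pow_nonneg (Nat.cast_nonneg _) 4) _)
  n22At_rateCarriers_of_kernels_pin_of_activitySlots_of_approxStable F 𝔯 θ hP g₀ os ℓ hs hpin m' hM S emb hloc Wk hWk sp Λ hA hr₁ hκ0 hκ hκ4 hrate hsmall hΛ hB₃ hδ₀ hr h238
    hYL Ec ιc Φ U hU hrU hHhol hΦemb hΦsp w hw₀ hw hwB lo hlo hρ hρ0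
    (approxStable_of_realTwoPoint F M S emb θ.ρ8 θ.bV (Window θ.γ) Wk hWk sp hA.le hr₁ hκ0 hκ hκ4 hrate (numerals_of_doubled hA.le hκ0.le hκ4 hsmall).1 hB₃ hδ₀ hr h238
      Ec ιc Φ U hU hrU hHhol hΦemb hΦsp w hw hwB lo hr₂ hr₂r hs0 hs1 hr₀pos hr₀1 hGR) hℓκ hdom k

open Classical in
/-- ★★★ **THE (D4) READ-OUT FACE KEYED ON (G≈ℝ)**: p611742's `readOutAt_rateCarriers_of_kernels_pin_of_activitySlots_of_approxStable` —
`ReadOutAt (datumOfRecord₁₃CoPH F N θ hP) (rateCarriersOfRecord₁₃CoPH 𝔯 F θ hP g₀ os k).u3` for every `k` under the pin and the letter rows `0 < ℓ.κ ≤ δ₁`, `betaPrime510 4 1 ℓ.κ ≤ ℓ.cr`,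
with (S≈) REPLACED by (G≈ℝ) + the dial `s` (one application of `approxStable_of_realTwoPoint`; dag-n27-w1's `readOutAt_objectsOfRecord₁₃_coPH` inside).  LOCATED; (D4) NOT discharged.
[cite: Balaban1987RG1, (1.20)-(1.21) p.264, (5.10) p.293; Balaban1988RG2Cluster, (1.26) p.8, (2.13)-(2.14) pp.14-15, (2.38) p.20] -/
theorem readOutAt_rateCarriers_of_kernels_pin_of_activitySlots_of_realTwoPoint (𝔯 : RateReading₁₃CoPH N) (θ : Stage13HParams F N) (hP : θ.Provisos₁₃CoPH F N)
    (g₀ : ℕ → ℝ) (os : List (ULoop F)) (ℓ : U3Letters₁₁) (hs : ℓ.Signs) (hℓ₀ : 0 < ℓ.κ) (hcr : betaPrime510 4 1 ℓ.κ ≤ ℓ.cr)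
    (hpin : (𝔯.lit F θ hP g₀ os).u3 = objectsOfRecord₁₃ F N θ.toStage13Params ℓ)
    (m' : ℕ) (hM : M = F.L ^ m')
    (S : (K : ℕ) → ClusterTower (F.P K) (MatA N) M) (emb : ReadingMaps F (MatA N) (MatA N)) (hloc : Localizes17OfRecord₁₃ F N θ.toStage13Params S emb)
    (Wk : (K k : ℕ) → Set (Fin (k + 1) → ℝ)) (hWk : ∀ g ∈ Window θ.γ, ∀ K k, histPrefix g k ∈ Wk K k)
    (sp : (K k : ℕ) → (domSys (F.P K) M (k + 1)).Dom → Set (CPair (F.P K) (MatA N))) {A R r₁ κ B₃ δ₀ r r₂ r₀ s : ℝ}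
    (hA : 0 ≤ A) (hr₁ : 0 ≤ r₁) (hκ0 : 0 < κ) (hκ : κ ≤ r₁) (hκ4 : kappa₀ (4 * 2 ^ 4) (2 * 4) ≤ κ / 2 / 2) (hrate : r₁ + 2 * (64 * Real.log 162) + 2 ≤ R)
    (hsmall : A * Real.exp (5 * r₁ + 1) * K₀ 64 8 * 9 * 64 ≤ 1) (hB₃ : 0 ≤ B₃) (hδ₀ : 0 < δ₀) (hr : 0 < r)
    (h238 : ∀ K k, ((S K) k).Bound238 (Wk K k) (sp K k) A R)
    (Ec : ℕ → ℕ → Type*) [∀ K k, NormedAddCommGroup (Ec K k)] [∀ K k, NormedSpace ℂ (Ec K k)]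
    (ιc : letI := θ.instVβ₁; letI := θ.instVβ₂; letI := θ.instιβ
      (K k : ℕ) → (domSys (F.P K) M (k + 1)).Dom → ((Fin (F.P K).d → Site (F.P K) (k + 1) → θ.Vβ) →L[ℝ] Ec K k))
    (Φ : (K k : ℕ) → (domSys (F.P K) M (k + 1)).Dom → Ec K k → CPair (F.P K) (MatA N))
    (U : (K k : ℕ) → (domSys (F.P K) M (k + 1)).Dom → Set (Ec K k)) (hU : ∀ K k X, IsOpen (U K k X)) (hrU : ∀ K k X, ball (0 : Ec K k) r ⊆ U K k X)
    (hHhol : ∀ K k, ∀ hist ∈ Wk K k, ∀ (X Z : (domSys (F.P K) M (k + 1)).Dom), Z.1 ⊆ X.1 →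
      DifferentiableOn ℂ (fun z => ((S K) k).H hist (Φ K k X z) Z) (U K k X))
    (hΦemb : letI := θ.instVβ₁; letI := θ.instVβ₂; letI := θ.instιβ
      ∀ K k X (B : Fin (F.P K).d → Site (F.P K) (k + 1) → θ.Vβ),
        Φ K k X (ιc K k X B) = emb K k (fun l t => NormedSpace.exp (θ.ρ8 (B l t))))
    (hΦsp : ∀ K k X, ∀ z ∈ U K k X, ∀ Z : (domSys (F.P K) M (k + 1)).Dom, Z.1 ⊆ X.1 → Φ K k X z ∈ sp K k Z)
    (w : (K k : ℕ) → (domSys (F.P K) M (k + 1)).Dom → Site (F.P K) (k + 1) → ℝ) (hw₀ : ∀ K k X t, 0 ≤ w K k X t)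
    (hw : letI := θ.instVβ₁; letI := θ.instVβ₂; letI := θ.instιβ
      ∀ K k X (l : Fin (F.P K).d) (t : Site (F.P K) (k + 1)) (c : θ.ιβ), ‖ιc K k X (Pi.single l (Pi.single t (θ.bV c)))‖ ≤ w K k X t)
    (hwB : ∀ K k (X : (domSys (F.P K) M (k + 1)).Dom) (t : Site (F.P K) (k + 1)),
      w K k X t ≤ B₃ * Real.exp (-δ₀ * distCT (domCount (F.P K) M (k + 1)) M (fun i => (ZMod.cast (t i) : ZMod (domCount (F.P K) M (k + 1) * M)))
        (nearT (M := M) (fun i => (ZMod.cast (t i) : ZMod (domCount (F.P K) M (k + 1) * M))) X)))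
    (lo : (k K : ℕ) → (domSys (F.P K) M (k + 1)).Dom → Prop) [∀ k K, DecidablePred (lo k K)]
    (hlo : ∀ (k K : ℕ) (X : (domSys (F.P K) M (k + 1)).Dom), ¬ lo k K X →
      let e : Site (F.P K) (k + 1) → TPt 4 (domCount (F.P K) M (k + 1) * M) := fun x i => (ZMod.cast (x i) : ZMod (domCount (F.P K) M (k + 1) * M))
      (K : ℝ) ≤ torusTreeLen X.1 ∨ (K : ℝ) ≤ distCT (domCount (F.P K) M (k + 1)) M (e (siteOfInt F K (k + 1) 0)) (nearT (M := M) (e (siteOfInt F K (k + 1) 0)) X))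
    (hr₂ : 0 < r₂) (hr₂r : (2 * B₃ + 1) * (2 * r₂) ≤ r) (hs0 : 0 < s) (hs1 : s < 1) (hr₀pos : 0 < r₀) (hr₀1 : r₀ ≤ 1)
    (hρ : (r₀ ^ (1 - s) * ((F.L : ℝ) ^ 4) ^ s) ^ (1 - s) * ((F.L : ℝ) ^ 4) ^ s < 1)
    (hGR : letI := θ.instVβ₁; letI := θ.instVβ₂; letI := θ.instιβ
      ∀ g ∈ Window θ.γ, ∀ (k : ℕ) (μ ν : Fin 4) (z : Fin 4 → ℤ), ∃ (K₀ : ℕ) (C : ℝ), ∀ K : ℕ, K₀ ≤ K → ∀ (c : θ.ιβ) (a b : ℝ), |a| ≤ r₂ → |b| ≤ r₂ →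
      ‖∑ X ∈ Finset.univ.filter (lo k (K + 1)), ((S (K + 1)) k).E (histPrefix g k) (emb (K + 1) k (fun l t => NormedSpace.exp (θ.ρ8
          ((a • (Pi.single (Fin.cast (F.P_d (K + 1)).symm μ) (Pi.single (siteOfInt F (K + 1) (k + 1) z) (θ.bV c)) : Fin (F.P (K + 1)).d → Site (F.P (K + 1)) (k + 1) → θ.Vβ) +
            b • (Pi.single (Fin.cast (F.P_d (K + 1)).symm ν) (Pi.single (siteOfInt F (K + 1) (k + 1) 0) (θ.bV c)) : Fin (F.P (K + 1)).d → Site (F.P (K + 1)) (k + 1) → θ.Vβ)) l t)))) X -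
        ∑ X ∈ Finset.univ.filter (lo k K), ((S K) k).E (histPrefix g k) (emb K k (fun l t => NormedSpace.exp (θ.ρ8
          ((a • (Pi.single (Fin.cast (F.P_d K).symm μ) (Pi.single (siteOfInt F K (k + 1) z) (θ.bV c)) : Fin (F.P K).d → Site (F.P K) (k + 1) → θ.Vβ) +
            b • (Pi.single (Fin.cast (F.P_d K).symm ν) (Pi.single (siteOfInt F K (k + 1) 0) (θ.bV c)) : Fin (F.P K).d → Site (F.P K) (k + 1) → θ.Vβ)) l t)))) X‖ ≤ C * r₀ ^ K)
    (hℓκ : ℓ.κ ≤ delta1 δ₀ κ ((M : ℝ) * 4)) (k : ℕ) :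
    ReadOutAt (datumOfRecord₁₃CoPH F N θ hP) (rateCarriersOfRecord₁₃CoPH 𝔯 F θ hP g₀ os k).u3 :=
  letI := θ.instVβ₁; letI := θ.instVβ₂; letI := θ.instιβ
  have hρ0 : 0 ≤ (r₀ ^ (1 - s) * ((F.L : ℝ) ^ 4) ^ s) ^ (1 - s) * ((F.L : ℝ) ^ 4) ^ s :=
    mul_nonneg (Real.rpow_nonneg (mul_nonneg (Real.rpow_nonneg hr₀pos.le _) (Real.rpow_nonneg (pow_nonneg (Nat.cast_nonneg _) 4) _)) _)
      (Real.rpow_nonneg (pow_nonneg (Nat.cast_nonneg _) 4) _)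
  readOutAt_rateCarriers_of_kernels_pin_of_activitySlots_of_approxStable F 𝔯 θ hP g₀ os ℓ hs hℓ₀ hcr hpin m' hM S emb hloc Wk hWk sp hA hr₁ hκ0 hκ hκ4 hrate hsmall hB₃ hδ₀ hr
    h238 Ec ιc Φ U hU hrU hHhol hΦemb hΦsp w hw₀ hw hwB lo hlo hρ hρ0
    (approxStable_of_realTwoPoint F M S emb θ.ρ8 θ.bV (Window θ.γ) Wk hWk sp hA hr₁ hκ0 hκ hκ4 hrate hsmall hB₃ hδ₀ hr h238
      Ec ιc Φ U hU hrU hHhol hΦemb hΦsp w hw hwB lo hr₂ hr₂r hs0 hs1 hr₀pos hr₀1 hGR) hℓκ k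

end Row

end YMDAG.N22.AtKernels

end
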